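import Summits.MatrixMultiplication.OmegaCensus.DominoZpZpGL2
import HarnessLib

/-!
# No domino cube law over `A ↠ ℤ_p × ℤ_p` from a certified line table with a cover (generic in the odd prime `p`)

ω-census `pub-omega`, family (b3), seat pub-omega-group gen 20.  Framing: lottery ticket; floor = certified bounds/negative
ranges.  VALUE: the generic form of the `ℤ_p²`-quotient domino cell theorems of the Dih-side mod-one classification (the
`p = 5` instances of gen 19 are `DominoZ5Z5Cells*.lean`); NOT progress on ω.

Method (gen 19, here for every odd prime `p`): `domino_shifted_form_of_law` ⇒ `X, Y, β, γ, x₀`; translate the image multiset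
of `X` under the quotient map `Φ` by `η·Φβ` (`η = ½ ∈ ZMod p`); a COVER hypothesis (`hcov`, supplied per `(p, |X|)` by the
kernel enumerations of `DominoZpZpCover.lean`) gives a line direction `j ≤ p` whose projection is a certified entry of the
line table `T`; the normalised line identity along `lineDir p j ∘ Φ` (`line_identity_of_shifted_form`) is the identity that
`lineCert_sound` excludes.  The `GL₂(𝔽_p)` normal form (explicit `basisEquiv` with inverse `D⁻¹·adj`) puts the multiset into
one of the three shapes the cover hypothesis assumes.

* `no_shifted_form_of_onto_zpzp_nf`, `no_shifted_form_of_onto_zpzp_of_cover` (+ swap) — shifted-form level;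
* `no_law_cube_1de_of_onto_zpzp_of_cover`, `no_law_cube_1d_e_of_onto_zpzp_of_cover` — TPP level: no triple with coset
  parts `(1,1 | d,d | e,e)` attains `3|S||T||U| + 8 = 8|A|` in a dihedral-like group over `A ↠ ℤ_p²` once part `d` (resp.
  `e`) has a certified table with a cover.
-/

namespace Summit.MatrixMultiplication.OmegaCensus

open Finset


/-! ## The core theorems -/

section Core

open ZpZpDomino

variable {p : ℕ} [Fact p.Prime] {A : Type*} [AddCommGroup A] [DecidableEq A] [Fintype A]

/-- **Core theorem under the normal-form hypothesis** (generic `p`; `η + η = 1`; translation by `Φ (η.val • β)`).  `hcov` is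
the cover statement for part size `|X|` (from `DominoZpZpCover.lean`; the table entry may match the count vector of a line
direction up to a unit SCALING `k` of `ZMod p`), `hT` the kernel certificate check of the table. [folklore] -/
theorem no_shifted_form_of_onto_zpzp_nf (η : ZMod p) (hη : η + η = 1) (Φ : A →+ ZMod p × ZMod p)
    (hΦ : Function.Surjective Φ) {X Y : Finset A} {β γ x₀ : A} (T : List (List ℕ × List (ℕ × List ℕ)))
    (hT : ∀ e ∈ T, lineCert p (vecFn e.1) e.2 = true) (i10 i01 : Fin (p * p)) (h10 : i10.val = p) (h01 : i01.val = 1)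
    (hcov : ∀ g : Fin (p * p) → ℕ, ∑ i, g i = X.card →
      ((1 ≤ g i10 ∧ 1 ≤ g i01) ∨ (1 ≤ g i10 ∧ ∀ i : Fin (p * p), i.val % p ≠ 0 → g i = 0) ∨
        (∀ i : Fin (p * p), i.val ≠ 0 → g i = 0)) →
      ∃ j < p + 1, ∃ k : ℕ, k % p ≠ 0 ∧ ∃ e ∈ T, ∀ v < p,
        e.1.getD (k * v % p) 0 = ∑ i : Fin (p * p), pick v (pv p j i.val) (g i))
    (hNF : (1 ≤ (X.filter fun a => Φ a = (1, 0) + Φ (η.val • β)).card ∧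
        1 ≤ (X.filter fun a => Φ a = (0, 1) + Φ (η.val • β)).card) ∨
      (1 ≤ (X.filter fun a => Φ a = (1, 0) + Φ (η.val • β)).card ∧
        ∀ u : ZMod p × ZMod p, u.2 ≠ 0 → (X.filter fun a => Φ a = u + Φ (η.val • β)).card = 0) ∨
      (∀ u : ZMod p × ZMod p, u ≠ 0 → (X.filter fun a => Φ a = u + Φ (η.val • β)).card = 0))
    (hinj : Set.InjOn (fun q : A × A => q.1 + q.2) ↑(X ×ˢ Y))
    (hPQ : Disjoint ((X ×ˢ Y).image fun q : A × A => q.1 + q.2)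
      (((Y ×ˢ X).image fun q : A × A => q.1 - q.2).image fun z => z + β))
    (hPR : Disjoint ((X ×ˢ Y).image fun q : A × A => q.1 + q.2)
      (((X ×ˢ Y).image fun q : A × A => q.1 - q.2).image fun z => z + γ))
    (hQR : Disjoint (((Y ×ˢ X).image fun q : A × A => q.1 - q.2).image fun z => z + β)
      (((X ×ˢ Y).image fun q : A × A => q.1 - q.2).image fun z => z + γ))
    (hcover : ((X ×ˢ Y).image fun q : A × A => q.1 + q.2) ∪
      (((Y ×ˢ X).image fun q : A × A => q.1 - q.2).image fun z => z + β) ∪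
      (((X ×ˢ Y).image fun q : A × A => q.1 - q.2).image fun z => z + γ) = univ.erase x₀) : False := by
  classical
  haveI : NeZero p := ⟨(Fact.out : p.Prime).ne_zero⟩
  set h : ZMod p × ZMod p := Φ (η.val • β) with hdef
  have hsumg : ∑ i : Fin (p * p), (X.filter fun a => Φ a = pt p i.val + h).card = X.card := by
    have h0 := sum_card_fibre_shift Φ X h
    rw [sum_eq_sum_pt] at h0
    exact h0
  -- the normal form on the value function
  have hNFg : (1 ≤ (X.filter fun a => Φ a = pt p i10.val + h).card ∧
        1 ≤ (X.filter fun a => Φ a = pt p i01.val + h).card) ∨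
      (1 ≤ (X.filter fun a => Φ a = pt p i10.val + h).card ∧
        ∀ i : Fin (p * p), i.val % p ≠ 0 → (X.filter fun a => Φ a = pt p i.val + h).card = 0) ∨
      (∀ i : Fin (p * p), i.val ≠ 0 → (X.filter fun a => Φ a = pt p i.val + h).card = 0) := by
    rw [h10, h01, pt_self, pt_one]
    rcases hNF with ⟨h10', h01'⟩ | ⟨h10', hax⟩ | h0
    · exact Or.inl ⟨h10', h01'⟩
    · exact Or.inr (Or.inl ⟨h10', fun i hi => hax _ (pt_snd_ne_zero hi)⟩)
    · exact Or.inr (Or.inr fun i hi => h0 _ (pt_ne_zero i.isLt hi))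
  -- a certified table entry for some line projection
  obtain ⟨j, hj, k, hk, e, he, hev⟩ := hcov (fun i => (X.filter fun a => Φ a = pt p i.val + h).card) hsumg hNFg
  -- the line identity along the scaled line form `a ↦ k · lineDir j (Φ a)`
  set kz : ZMod p := ((k : ℕ) : ZMod p) with hkzdef
  have hkz : kz ≠ 0 := by
    rw [hkzdef, ne_eq, ZMod.natCast_eq_zero_iff]
    exact fun hdvd => hk (Nat.mod_eq_zero_of_dvd hdvd)
  set π : ZMod p × ZMod p →+ ZMod p := lineDir p j with hπ
  set φ : A →+ ZMod p := (AddMonoidHom.mulLeft kz).comp (π.comp Φ) with hφ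
  have hφsurj : Function.Surjective φ := by
    refine Function.Surjective.comp (g := AddMonoidHom.mulLeft kz) (fun t => ⟨kz⁻¹ * t, ?_⟩)
      ((lineDir_surjective p j).comp hΦ)
    show kz * (kz⁻¹ * t) = t
    rw [← mul_assoc, mul_inv_cancel₀ hkz, one_mul]
  have hFw : ∀ w : ZMod p, (X.filter fun a => φ a = w + η * φ β).card = vecFn e.1 w := by
    intro w
    set v : ZMod p := kz⁻¹ * w with hv
    have hw : w = kz * v := by rw [hv, ← mul_assoc, mul_inv_cancel₀ hkz, one_mul]
    have hval : w.val = k * v.val % p := by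
      rw [hw, ZMod.val_mul, hkzdef, ZMod.val_natCast, Nat.mod_mul_mod]
    have e1 := hev v.val (ZMod.val_lt v)
    have e2 := sum_filter_eq_sum_pick p j (fun u => (X.filter fun a => Φ a = u + h).card) (ZMod.val_lt v)
    beta_reduce at e2
    rw [← e2, ZMod.natCast_zmod_val, sum_filter_card_fibre_shift Φ π X h v] at e1
    show _ = e.1.getD w.val 0
    rw [hval, e1]
    refine congrArg Finset.card (Finset.filter_congr fun a _ => ?_)
    have eφ : ∀ x, φ x = kz * π (Φ x) := fun x => rfl
    have eh : π h = η * π (Φ β) := by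
      rw [hdef, map_nsmul, map_nsmul, nsmul_eq_mul, ZMod.natCast_zmod_val]
    rw [eφ, eφ, hw]
    constructor
    · intro e3
      have : kz * π (Φ a) = kz * (v + η * π (Φ β)) := by rw [e3]; ring
      rw [mul_right_injective₀ hkz this, eh]
    · intro e3
      rw [e3, eh]; ring
  have hid : ∀ τ : ZMod p, (∑ v : ZMod p, (vecFn e.1 (τ - v) + vecFn e.1 (v - τ) + vecFn e.1 (τ + v)) *
        (Y.filter fun a => φ a = v + η * φ γ).card) + (if φ x₀ - η * φ β - η * φ γ = τ then 1 else 0) =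
        (univ.filter fun a : A => φ a = 0).card := fun τ => by
    have h0 := line_identity_of_shifted_form φ η hη hinj hPQ hPR hQR hcover τ
    rw [card_fibre_eq_of_surjective φ hφsurj (τ + η * φ β + η * φ γ) 0] at h0
    simp only [hFw] at h0
    exact h0
  exact lineCert_sound (hT e he) _ _ _ hid

/-- **Core theorem for any surjection `Φ : A ↠ ℤ_p²`, given a certified table with a cover for `|X|`** (the normal form
is reached by `GL₂(𝔽_p)`). [folklore] -/
theorem no_shifted_form_of_onto_zpzp_of_cover (η : ZMod p) (hη : η + η = 1) (Φ : A →+ ZMod p × ZMod p)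
    (hΦ : Function.Surjective Φ) {X Y : Finset A} {β γ x₀ : A} (T : List (List ℕ × List (ℕ × List ℕ)))
    (hT : ∀ e ∈ T, lineCert p (vecFn e.1) e.2 = true) (i10 i01 : Fin (p * p)) (h10 : i10.val = p) (h01 : i01.val = 1)
    (hcov : ∀ g : Fin (p * p) → ℕ, ∑ i, g i = X.card →
      ((1 ≤ g i10 ∧ 1 ≤ g i01) ∨ (1 ≤ g i10 ∧ ∀ i : Fin (p * p), i.val % p ≠ 0 → g i = 0) ∨
        (∀ i : Fin (p * p), i.val ≠ 0 → g i = 0)) →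
      ∃ j < p + 1, ∃ k : ℕ, k % p ≠ 0 ∧ ∃ e ∈ T, ∀ v < p,
        e.1.getD (k * v % p) 0 = ∑ i : Fin (p * p), pick v (pv p j i.val) (g i))
    (hinj : Set.InjOn (fun q : A × A => q.1 + q.2) ↑(X ×ˢ Y))
    (hPQ : Disjoint ((X ×ˢ Y).image fun q : A × A => q.1 + q.2)
      (((Y ×ˢ X).image fun q : A × A => q.1 - q.2).image fun z => z + β))
    (hPR : Disjoint ((X ×ˢ Y).image fun q : A × A => q.1 + q.2)
      (((X ×ˢ Y).image fun q : A × A => q.1 - q.2).image fun z => z + γ))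
    (hQR : Disjoint (((Y ×ˢ X).image fun q : A × A => q.1 - q.2).image fun z => z + β)
      (((X ×ˢ Y).image fun q : A × A => q.1 - q.2).image fun z => z + γ))
    (hcover : ((X ×ˢ Y).image fun q : A × A => q.1 + q.2) ∪
      (((Y ×ˢ X).image fun q : A × A => q.1 - q.2).image fun z => z + β) ∪
      (((X ×ˢ Y).image fun q : A × A => q.1 - q.2).image fun z => z + γ) = univ.erase x₀) : False := by
  classical
  by_cases hA : ∃ v₁ : ZMod p × ZMod p, v₁ ≠ 0 ∧ 1 ≤ (X.filter fun a => Φ a = v₁ + Φ (η.val • β)).card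
  · obtain ⟨v₁, hv₁, hF₁⟩ := hA
    by_cases hB : ∃ v₂ : ZMod p × ZMod p, (∀ k : ZMod p, v₂ ≠ (k * v₁.1, k * v₁.2)) ∧
        1 ≤ (X.filter fun a => Φ a = v₂ + Φ (η.val • β)).card
    · -- normal form (i)
      obtain ⟨v₂, hv₂, hF₂⟩ := hB
      have hD := det_ne_zero_of_not_mul v₁ v₂ hv₁ hv₂
      set E := basisEquiv v₁ v₂ hD with hE
      refine no_shifted_form_of_onto_zpzp_nf η hη (E.symm.toAddMonoidHom.comp Φ) (E.symm.surjective.comp hΦ) T hT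
        i10 i01 h10 h01 hcov (Or.inl ⟨?_, ?_⟩) hinj hPQ hPR hQR hcover
      · have e := card_fibre_shift_comp_equiv E.symm Φ X (η.val • β) v₁
        rw [show E.symm v₁ = (1, 0) by
          rw [AddEquiv.symm_apply_eq]; exact (basisEquiv_one_zero v₁ v₂ hD).symm] at e
        rw [e]; exact hF₁
      · have e := card_fibre_shift_comp_equiv E.symm Φ X (η.val • β) v₂
        rw [show E.symm v₂ = (0, 1) by
          rw [AddEquiv.symm_apply_eq]; exact (basisEquiv_zero_one v₁ v₂ hD).symm] at e
        rw [e]; exact hF₂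
    · -- normal form (ii)
      obtain ⟨v₂, hD⟩ := exists_det_ne_zero v₁ hv₁
      set E := basisEquiv v₁ v₂ hD with hE
      refine no_shifted_form_of_onto_zpzp_nf η hη (E.symm.toAddMonoidHom.comp Φ) (E.symm.surjective.comp hΦ) T hT
        i10 i01 h10 h01 hcov (Or.inr (Or.inl ⟨?_, fun w hw => ?_⟩)) hinj hPQ hPR hQR hcover
      · have e := card_fibre_shift_comp_equiv E.symm Φ X (η.val • β) v₁
        rw [show E.symm v₁ = (1, 0) by
          rw [AddEquiv.symm_apply_eq]; exact (basisEquiv_one_zero v₁ v₂ hD).symm] at e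
        rw [e]; exact hF₁
      · have e := card_fibre_shift_comp_equiv E.symm Φ X (η.val • β) (E w)
        rw [AddEquiv.symm_apply_apply] at e
        rw [e]
        by_contra hne
        have hpos : 1 ≤ (X.filter fun a => Φ a = E w + Φ (η.val • β)).card := Nat.one_le_iff_ne_zero.2 hne
        -- `E w` must be a multiple of `v₁`, i.e. `w` lies on the axis
        have hmul : ∃ k : ZMod p, E w = (k * v₁.1, k * v₁.2) := by
          by_contra hk
          exact hB ⟨E w, fun k e' => hk ⟨k, e'⟩, hpos⟩
        obtain ⟨k, hk⟩ := hmul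
        rw [← basisEquiv_axis v₁ v₂ hD k] at hk
        have hwk : w = (k, 0) := E.injective hk
        exact hw (by rw [hwk])
  · -- normal form (iii)
    refine no_shifted_form_of_onto_zpzp_nf η hη Φ hΦ T hT i10 i01 h10 h01 hcov
      (Or.inr (Or.inr fun u hu => ?_)) hinj hPQ hPR hQR hcover
    by_contra hne
    exact hA ⟨u, hu, Nat.one_le_iff_ne_zero.2 hne⟩

/-- **Core theorem, parts swapped** (cover hypothesis for `|Y|`): the form is symmetric under `(X, β) ↔ (Y, γ)`.
[folklore] -/
theorem no_shifted_form_of_onto_zpzp_of_cover' (η : ZMod p) (hη : η + η = 1) (Φ : A →+ ZMod p × ZMod p)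
    (hΦ : Function.Surjective Φ) {X Y : Finset A} {β γ x₀ : A} (T : List (List ℕ × List (ℕ × List ℕ)))
    (hT : ∀ e ∈ T, lineCert p (vecFn e.1) e.2 = true) (i10 i01 : Fin (p * p)) (h10 : i10.val = p) (h01 : i01.val = 1)
    (hcov : ∀ g : Fin (p * p) → ℕ, ∑ i, g i = Y.card →
      ((1 ≤ g i10 ∧ 1 ≤ g i01) ∨ (1 ≤ g i10 ∧ ∀ i : Fin (p * p), i.val % p ≠ 0 → g i = 0) ∨
        (∀ i : Fin (p * p), i.val ≠ 0 → g i = 0)) →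
      ∃ j < p + 1, ∃ k : ℕ, k % p ≠ 0 ∧ ∃ e ∈ T, ∀ v < p,
        e.1.getD (k * v % p) 0 = ∑ i : Fin (p * p), pick v (pv p j i.val) (g i))
    (hinj : Set.InjOn (fun q : A × A => q.1 + q.2) ↑(X ×ˢ Y))
    (hPQ : Disjoint ((X ×ˢ Y).image fun q : A × A => q.1 + q.2)
      (((Y ×ˢ X).image fun q : A × A => q.1 - q.2).image fun z => z + β))
    (hPR : Disjoint ((X ×ˢ Y).image fun q : A × A => q.1 + q.2)
      (((X ×ˢ Y).image fun q : A × A => q.1 - q.2).image fun z => z + γ))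
    (hQR : Disjoint (((Y ×ˢ X).image fun q : A × A => q.1 - q.2).image fun z => z + β)
      (((X ×ˢ Y).image fun q : A × A => q.1 - q.2).image fun z => z + γ))
    (hcover : ((X ×ˢ Y).image fun q : A × A => q.1 + q.2) ∪
      (((Y ×ˢ X).image fun q : A × A => q.1 - q.2).image fun z => z + β) ∪
      (((X ×ˢ Y).image fun q : A × A => q.1 - q.2).image fun z => z + γ) = univ.erase x₀) : False := by
  have himg := image_add_swap X Y
  refine no_shifted_form_of_onto_zpzp_of_cover η hη Φ hΦ (X := Y) (Y := X) (β := γ) (γ := β) (x₀ := x₀) T hT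
    i10 i01 h10 h01 hcov (injOn_add_swap hinj) ?_ ?_ hQR.symm ?_
  · rw [himg]; exact hPR
  · rw [himg]; exact hPQ
  · rw [himg, union_right_comm]; exact hcover

/-- An unscaled cover statement (`k = 1`) gives the scaled one used above. [folklore] -/
theorem ZpZpDomino.cover_scaled_of_unscaled {d : ℕ} {T : List (List ℕ × List (ℕ × List ℕ))} {i10 i01 : Fin (p * p)}
    (hcov : ∀ g : Fin (p * p) → ℕ, ∑ i, g i = d →
      ((1 ≤ g i10 ∧ 1 ≤ g i01) ∨ (1 ≤ g i10 ∧ ∀ i : Fin (p * p), i.val % p ≠ 0 → g i = 0) ∨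
        (∀ i : Fin (p * p), i.val ≠ 0 → g i = 0)) →
      ∃ j < p + 1, ∃ e ∈ T, ∀ v < p, e.1.getD v 0 = ∑ i : Fin (p * p), pick v (pv p j i.val) (g i))
    (g : Fin (p * p) → ℕ) (hg : ∑ i, g i = d)
    (hNF : (1 ≤ g i10 ∧ 1 ≤ g i01) ∨ (1 ≤ g i10 ∧ ∀ i : Fin (p * p), i.val % p ≠ 0 → g i = 0) ∨
      (∀ i : Fin (p * p), i.val ≠ 0 → g i = 0)) :
    ∃ j < p + 1, ∃ k : ℕ, k % p ≠ 0 ∧ ∃ e ∈ T, ∀ v < p,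
      e.1.getD (k * v % p) 0 = ∑ i : Fin (p * p), pick v (pv p j i.val) (g i) := by
  obtain ⟨j, hj, e, he, hev⟩ := hcov g hg hNF
  have hp : 1 < p := (Fact.out : p.Prime).one_lt
  refine ⟨j, hj, 1, by rw [Nat.mod_eq_of_lt hp]; exact one_ne_zero, e, he, fun v hv => ?_⟩
  rw [one_mul, Nat.mod_eq_of_lt hv]
  exact hev v hv

end Core

/-! ## The TPP statements -/

section DihedralLike

open ZpZpDomino Literature.Combinatorics.Additive

variable {p : ℕ} [Fact p.Prime] {A : Type} [AddCommGroup A] [DecidableEq A] [Fintype A] {G : Type} [Group G]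
  [DecidableEq G] {ρ τ : A → G} {c₀ : A} {S T U : Finset G}

/-- **No `(1,1 | d,d | e,e)` law triple over `A ↠ ℤ_p × ℤ_p` whenever the certified table for part `d` has a cover**
(the `d`-parts in `T`): dihedral-like `G` over `A` (any `c₀`), `φ` onto, TPP, coset parts `(1,1 | d,d | e,e)` ⇒
`3|S||T||U| + 8 ≠ 8|A|`. [folklore] -/
theorem no_law_cube_1de_of_onto_zpzp_of_cover (η : ZMod p) (hη : η + η = 1) {d : ℕ}
    (Tb : List (List ℕ × List (ℕ × List ℕ))) (hTb : ∀ e ∈ Tb, lineCert p (vecFn e.1) e.2 = true)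
    (i10 i01 : Fin (p * p)) (h10 : i10.val = p) (h01 : i01.val = 1)
    (hcov : ∀ g : Fin (p * p) → ℕ, ∑ i, g i = d →
      ((1 ≤ g i10 ∧ 1 ≤ g i01) ∨ (1 ≤ g i10 ∧ ∀ i : Fin (p * p), i.val % p ≠ 0 → g i = 0) ∨
        (∀ i : Fin (p * p), i.val ≠ 0 → g i = 0)) →
      ∃ j < p + 1, ∃ k : ℕ, k % p ≠ 0 ∧ ∃ e ∈ Tb, ∀ v < p,
        e.1.getD (k * v % p) 0 = ∑ i : Fin (p * p), pick v (pv p j i.val) (g i))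
    (hρρ : ∀ a b, ρ a * ρ b = ρ (a + b)) (hρτ : ∀ a b, ρ a * τ b = τ (b - a))
    (hτρ : ∀ a b, τ a * ρ b = τ (a + b)) (hττ : ∀ a b, τ a * τ b = ρ (c₀ + b - a))
    (hρ : Function.Injective ρ) (hτ : Function.Injective τ) (hne : ∀ a b, ρ a ≠ τ b)
    (hsurj : ∀ g, (∃ a, ρ a = g) ∨ (∃ a, τ a = g))
    (φ : A →+ ZMod p × ZMod p) (hφ : Function.Surjective φ)
    (h : TripleProductProperty S T U)
    (hS₀ : (univ.filter fun a : A => ρ a ∈ S).card = 1) (hS₁ : (univ.filter fun a : A => τ a ∈ S).card = 1)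
    (hT₀ : (univ.filter fun a : A => ρ a ∈ T).card = d) (hT₁ : (univ.filter fun a : A => τ a ∈ T).card = d)
    (hU : (univ.filter fun a : A => ρ a ∈ U).card = (univ.filter fun a : A => τ a ∈ U).card)
    (hV : 3 * (S.card * T.card * U.card) + 8 = 8 * Fintype.card A) : False := by
  classical
  obtain ⟨X, Y, β, γ, x₀, hXc, -, hinj, hPQ, hPR, hQR, hcover⟩ :=
    domino_shifted_form_of_law hρρ hρτ hτρ hττ hρ hτ hne hsurj h hS₀ hS₁ (by rw [hT₀, hT₁]) hU hV
  rw [hT₀] at hXc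
  subst hXc
  exact no_shifted_form_of_onto_zpzp_of_cover η hη φ hφ Tb hTb i10 i01 h10 h01 hcov hinj hPQ hPR hQR hcover

/-- **No `(1,1 | d,d | e,e)` law triple over `A ↠ ℤ_p × ℤ_p` whenever the certified table for part `e` has a cover**
(the `e`-parts in `U`). [folklore] -/
theorem no_law_cube_1d_e_of_onto_zpzp_of_cover (η : ZMod p) (hη : η + η = 1) {e : ℕ}
    (Tb : List (List ℕ × List (ℕ × List ℕ))) (hTb : ∀ x ∈ Tb, lineCert p (vecFn x.1) x.2 = true)
    (i10 i01 : Fin (p * p)) (h10 : i10.val = p) (h01 : i01.val = 1)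
    (hcov : ∀ g : Fin (p * p) → ℕ, ∑ i, g i = e →
      ((1 ≤ g i10 ∧ 1 ≤ g i01) ∨ (1 ≤ g i10 ∧ ∀ i : Fin (p * p), i.val % p ≠ 0 → g i = 0) ∨
        (∀ i : Fin (p * p), i.val ≠ 0 → g i = 0)) →
      ∃ j < p + 1, ∃ k : ℕ, k % p ≠ 0 ∧ ∃ x ∈ Tb, ∀ v < p,
        x.1.getD (k * v % p) 0 = ∑ i : Fin (p * p), pick v (pv p j i.val) (g i))
    (hρρ : ∀ a b, ρ a * ρ b = ρ (a + b)) (hρτ : ∀ a b, ρ a * τ b = τ (b - a))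
    (hτρ : ∀ a b, τ a * ρ b = τ (a + b)) (hττ : ∀ a b, τ a * τ b = ρ (c₀ + b - a))
    (hρ : Function.Injective ρ) (hτ : Function.Injective τ) (hne : ∀ a b, ρ a ≠ τ b)
    (hsurj : ∀ g, (∃ a, ρ a = g) ∨ (∃ a, τ a = g))
    (φ : A →+ ZMod p × ZMod p) (hφ : Function.Surjective φ)
    (h : TripleProductProperty S T U)
    (hS₀ : (univ.filter fun a : A => ρ a ∈ S).card = 1) (hS₁ : (univ.filter fun a : A => τ a ∈ S).card = 1)
    (hT : (univ.filter fun a : A => ρ a ∈ T).card = (univ.filter fun a : A => τ a ∈ T).card)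
    (hU₀ : (univ.filter fun a : A => ρ a ∈ U).card = e) (hU₁ : (univ.filter fun a : A => τ a ∈ U).card = e)
    (hV : 3 * (S.card * T.card * U.card) + 8 = 8 * Fintype.card A) : False := by
  classical
  obtain ⟨X, Y, β, γ, x₀, -, hYc, hinj, hPQ, hPR, hQR, hcover⟩ :=
    domino_shifted_form_of_law hρρ hρτ hτρ hττ hρ hτ hne hsurj h hS₀ hS₁ hT (by rw [hU₀, hU₁]) hV
  rw [hU₀] at hYc
  subst hYc
  exact no_shifted_form_of_onto_zpzp_of_cover' η hη φ hφ Tb hTb i10 i01 h10 h01 hcov hinj hPQ hPR hQR hcover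

end DihedralLike


end Summit.MatrixMultiplication.OmegaCensus
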